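import Summits.SmoothPoincare4.SmoothPoincare4.Theorems.EntropyRungNoncompactShrinkerGapGradientFlow
import Summits.SmoothPoincare4.SmoothPoincare4.Theorems.EntropyRungNoncompactShrinkerGapCanonicalFlow
import HarnessLib

/-!
# The canonical Ricci flow of a complete gradient shrinking soliton — unconditional
# (crux `EntropyRung.NoncompactShrinkerGap`, stmt-SmoothPoincare4-10868, line `collapsed-ends-usc`,
# lead c15, brick 3 of the printed chain of `ShrinkerSplittingAtInfinity`, stmt-16588)

Naber 2010, Lemma 1.1 / Chow–Lu–Ni 2006, Thm. 4.1 / Bertellotti–Buzano 2025, §2, (2.8): a complete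
connected normalised gradient shrinking Ricci soliton `(Mⁿ, g, f)` — `Ric + Hess f = g/2`,
`R + |∇f|² = f`, closed `g.edist`-balls compact — generates

* the GLOBAL gradient flow `θ : ℝ × M → M` of `∇f` (`helper_shrinkerGradientFlow`, W6 p167180:
  completeness of `grad_g f` from `d/dt f(γ) = |∇f|² ≤ f` and the properness of `f`, then the
  tree's flow theory `exists_isMIntegralCurve_of_apriori_isCompact`,
  `exists_contMDiff_globalFlow_of_complete`), with `f` non-decreasing along `θ` and
  `f(θ(t, p)) ≤ eᵗ f(p)` for `t ≥ 0`;
* the CANONICAL ANCIENT RICCI FLOW `g(t) = (1 − t) ψ_t^* g`, `ψ_t = θ(−log(1 − t), ·)`, `t < 1`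
  (`helper_shrinkerCanonicalFlow_of`, W7 p168051: `IsRicciFlow` on `Iio 1` by Topping's
  Prop. 1.2.1 `hasDerivWithinAt_val_pullback_family`, `ℒ_{∇f} g = 2 Hess f`, naturality of `Ric`
  under the local diffeomorphisms `ψ_t`), with `g(0) = g`, `∂_t ψ_t = (1−t)⁻¹ ∇f ∘ ψ_t`,
  `Ric_{g(t)} = ψ_t^* Ric_g`, `R_{g(t)} = (1 − t)⁻¹ R_g ∘ ψ_t`, and the TYPE I bound
  `|Rm_g| ≤ C ⇒ |Rm_{g(t)}| ≤ C/(1 − t)` (frame-wise `CurvatureBoundedBy`).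

This file only composes the two (`helper_shrinkerCanonicalFlow`). With c14's Munteanu–Wang
curvature bound (`FourShrinker.curvNormSq_bounded`) the flow of a 4-d shrinker with bounded `R` is a
complete Type I ancient solution; with c15's `helper_shrinkerNoncollapsing` it is non-collapsed at
the base scale — the hypotheses of Hamilton–Cheeger–Gromov compactness / Enders–Müller–Topping at
the escaping base points `x_k = ψ_{t_k}(q)`.

## References

* A. Naber, *Noncompact shrinking four solitons with nonnegative curvature*, J. reine angew. Math.
  645 (2010), Lemma 1.1. [Naber2010]
* B. Chow, P. Lu, L. Ni, *Hamilton's Ricci flow*, GSM 77 (2006), Thm. 4.1. [ChowLuNi2006]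
* A. Bertellotti, R. Buzano, *Geometric structure of ends of Ricci shrinkers*, arXiv:2508.10790,
  §2, (2.8). [BertellottiBuzano2025]
* P. Topping, *Lectures on the Ricci flow* (2006), Prop. 1.2.1. [Topping2006]
-/

noncomputable section

set_option linter.dupNamespace false

open scoped Manifold ContDiff ENNReal NNReal Topology
open MeasureTheory Set Filter Module
open Literature.Geometry.Lorentzian Literature.Geometry.Riemannian Literature.Geometry.Manifold

namespace Summit.SmoothPoincare4.SmoothPoincare4.Theorems.NoncompactShrinkerGapNoncollapsing

/-- **The canonical ancient Type-I Ricci flow of a complete gradient shrinking soliton**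
(Naber 2010, Lemma 1.1; Chow–Lu–Ni 2006, Thm. 4.1): for a complete connected normalised gradient
shrinker `(Mⁿ, g, f)` there are the global gradient flow `θ` of `∇f` (smooth, `θ(0, ·) = id`,
group law, orbits = integral curves of `grad_g f`, `f` non-decreasing along it,
`f(θ(t,p)) ≤ eᵗ f(p)` for `t ≥ 0`) and a Ricci flow `(G, cov)` on `(−∞, 1)` with
`G t = (1 − t) ψ_t^* g`, `ψ_t = θ(−log(1−t), ·)`, `G 0 = g`, `∂_t ψ_t = (1−t)⁻¹ ∇f ∘ ψ_t`,
`Ric_{cov t} = ψ_t^* Ric_g`, `R_{G t} = (1−t)⁻¹ R_g ∘ ψ_t`, and `|Rm_g| ≤ C ⇒ |Rm_{G t}| ≤ C/(1−t)`.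
Composition of `helper_shrinkerGradientFlow` (W6) and `helper_shrinkerCanonicalFlow_of` (W7).
[cite: Naber2010, Lemma 1.1] [cite: Topping2006, Prop. 1.2.1] -/
theorem helper_shrinkerCanonicalFlow : ∀ (n : ℕ) (M : Type) [TopologicalSpace M] [T2Space M] [SecondCountableTopology M] [ChartedSpace (EuclideanSpace ℝ (Fin n)) M] [IsManifold (𝓡 n) ∞ M] [ConnectedSpace M] [T3Space M] [MeasurableSpace M] [BorelSpace M] (g : PseudoRiemannianMetric (𝓡 n) ∞ (EuclideanSpace ℝ (Fin n)) (TangentSpace (𝓡 n) : M → Type _)) [g.HasLeviCivita] (f : M → ℝ) (hg : g.IsRiemannian), (∀ (x : M) (r : NNReal), IsCompact {y : M | g.edist hg x y ≤ r}) → ContMDiff (𝓡 n) 𝓘(ℝ, ℝ) ∞ f → (∀ (x : M) (X Y : TangentSpace (𝓡 n) x), g.ricci x X Y + g.hessian f x X Y = (1 / 2 : ℝ) * g.val x X Y) → (∀ x : M, g.scalarCurvature x + g.gradSq f x = f x) → ∃ (θ : ℝ × M → M) (G : ℝ → PseudoRiemannianMetric (𝓡 n) ∞ (EuclideanSpace ℝ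 (Fin n)) (TangentSpace (𝓡 n) : M → Type _)) (cov : ℝ → CovariantDerivative (𝓡 n) (EuclideanSpace ℝ (Fin n)) (TangentSpace (𝓡 n) : M → Type _)), ContMDiff (𝓘(ℝ, ℝ).prod (𝓡 n)) (𝓡 n) ∞ θ ∧ (∀ p, θ (0, p) = p) ∧ (∀ t s p, θ (t, θ (s, p)) = θ (t + s, p)) ∧ (∀ p, IsMIntegralCurve (fun t ↦ θ (t, p)) (Literature.Geometry.Riemannian.grad g f)) ∧ (∀ p s t, s ≤ t → f (θ (s, p)) ≤ f (θ (t, p))) ∧ (∀ p t, 0 ≤ t → f (θ (t, p)) ≤ Real.exp t * f p) ∧ IsRicciFlow G cov (Set.Iio 1) ∧ (∀ t, t < 1 → (G t).IsRiemannian) ∧ (∀ t, t < 1 → ∀ (u : M) (v w : TangentSpace (𝓡 n) u), (G t).val u v w = (1 - t) * g.val (θ (-Real.log (1 - t), u)) (mfderiv (𝓡 n) (𝓡 n) (fun x ↦ θ (-Real.log (1 - t), x)) u v) (mfderiv (𝓡 n) (𝓡 n) (fun x ↦ θ (-Real.log (1 - t), x)) u w)) ∧ (∀ (u : M) (v w :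 TangentSpace (𝓡 n) u), (G 0).val u v w = g.val u v w) ∧ (∀ u : M, IsTimeDepMIntegralCurveOn (fun t ↦ θ (-Real.log (1 - t), u)) (fun t x ↦ (1 - t)⁻¹ • Literature.Geometry.Riemannian.grad g f x) (Set.Iio 1)) ∧ (∀ t, t < 1 → ∀ (u : M) (v w : TangentSpace (𝓡 n) u), (cov t).ricci u v w = g.ricci (θ (-Real.log (1 - t), u)) (mfderiv (𝓡 n) (𝓡 n) (fun x ↦ θ (-Real.log (1 - t), x)) u v) (mfderiv (𝓡 n) (𝓡 n) (fun x ↦ θ (-Real.log (1 - t), x)) u w)) ∧ (∀ t, t < 1 → ∀ u : M, (G t).scalarCurvatureWith (cov t) u = (1 - t)⁻¹ * g.scalarCurvature (θ (-Real.log (1 - t), u))) ∧ ∀ C : ℝ, CurvatureBoundedBy g g.leviCivita C → ∀ t, t < 1 → CurvatureBoundedBy (G t) (cov t) (C / (1 - t)) := by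
  intro n M _ _ _ _ _ _ _ _ _ g _ f hg hc hf hsol hnorm
  obtain ⟨θ, hθs, hθ0, hθgrp, hθint, hθmono, hθexp⟩ :=
    helper_shrinkerGradientFlow n M g f hg hc hf hsol hnorm
  obtain ⟨G, cov, hflow, hRiem, hval, hval0, htd, hric, hscal, htypeI⟩ :=
    helper_shrinkerCanonicalFlow_of n M g f hg hf hsol θ hθs hθ0 hθgrp hθint
  exact ⟨θ, G, cov, hθs, hθ0, hθgrp, hθint, hθmono, hθexp, hflow, hRiem, hval, hval0, htd, hric,
    hscal, htypeI⟩

end Summit.SmoothPoincare4.SmoothPoincare4.Theorems.NoncompactShrinkerGapNoncollapsing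

end
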